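import Summits.AtomisticToContinuum.HydrodynamicLimit.Theorems.CollisionIsometryCLTAdaptedWeightCLTBHPerContactBregman
import Summits.AtomisticToContinuum.HydrodynamicLimit.Theorems.CollisionIsometryCLTAdaptedWeightCLTBHEntropyBudgetGauss
import Summits.AtomisticToContinuum.HydrodynamicLimit.Theorems.CollisionIsometryCLTAdaptedWeightCLTBHEEPClosurePinsker

/-!
# Per-contact inputs of the line `block-h-dissipation-closure` (crux `AdaptedWeightCLT`,
stmt-AtomisticToContinuum-14868; stub `stub_perContact`, `--supports`) — helper 2: relative entropies of the
Gaussians of the cell law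

The regularised cell law `f̂ = (1 − δ) W⁻¹ Σₖ cwₖ G_h(· − vₖ) + δ M_{θ̄+h², ū}` is a mixture of Gaussians; at a
contact two bumps move (`vᵢ, vⱼ ↦ vᵢ', vⱼ'`) and the co-moving floor shifts (`ū, θ̄` move). The log-sum
inequality (helper 1) reduces the Bregman remainder to Gaussian relative entropies, computed here on `V3 = ℝ³`
for `M_{s,U} = localMaxwellian 1 s U` in the explicit Bregman form `breg(a, b) = a (log a − log b) − a + b`:
* `log M_{s,U}(v) = −(3/2) log(2πs) − |v − U|²/(2s)` (`log_lM_eq`);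
* `∫ breg(M_{s₁,U₁}, M_{s₀,U₀}) = (3/2)(s₁/s₀ − 1 − log(s₁/s₀)) + |U₁ − U₀|²/(2 s₀)` (`integral_breg_lM`, with
  integrability `integrable_breg_lM`); in particular `∫ breg(G_h(· − u₁), G_h(· − u₀)) = |u₁ − u₀|²/(2h²)`
  (`integral_breg_gauss`);
* the bounds `KL ≤ (3/2)|s₁ − s₀|/min(s₀,s₁) + |ΔU|²/(2s₀)` (always) and `KL ≤ 3((s₁ − s₀)/s₀)² + |ΔU|²/(2s₀)`
  (perturbative, `|s₁ − s₀| ≤ s₀/2`);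
* the `L¹` CONSEQUENCE (parametric Csiszár–Kullback–Pinsker of `…BHEEPClosurePinsker`):
  `∫ |M₁ − M₀| ≤ 2c` whenever `KL(M₁‖M₀) ≤ c²` (`integral_abs_lM_sub_lM_le`).
-/

namespace Summit.AtomisticToContinuum.HydrodynamicLimit.Theorems.BlockHDissipation

open scoped BigOperators Topology Classical MeasureTheory ENNReal InnerProductSpace
open Filter Set MeasureTheory Real
open Literature.Analysis.FluidPDE
open Summit.AtomisticToContinuum.HydrodynamicLimit.Theorems.ContactSourceDuhamel (T3 V3 Cfg Vel Flow Flows)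
open Literature.MathematicalPhysics.KineticTheory (localMaxwellian_pos localMaxwellian_nonneg continuous_localMaxwellian)

noncomputable section

namespace PerContact

open EntropyBudget

/-! ## The logarithm of the Maxwellian -/

/-- `log M_{s,U}(v) = −(3/2) log(2πs) − |v − U|²/(2s)`. -/
theorem log_lM_eq {s : ℝ} (hs : 0 < s) (U v : V3) :
    log (localMaxwellian 1 s U v) = -(3 / 2) * log (2 * Real.pi * s) - ‖v - U‖ ^ 2 / (2 * s) :=
  le_antisymm (log_lM_le' hs U v) (log_lM_ge' hs U v)

/-- The Bregman integrand of two Maxwellians, expanded: `breg(M₁, M₀)(v) =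
M₁(v) · ((3/2)(log(2πs₀) − log(2πs₁)) − |v−U₁|²/(2s₁) + |v−U₀|²/(2s₀)) − M₁(v) + M₀(v)`. -/
theorem breg_lM_eq {s₀ s₁ : ℝ} (h₀ : 0 < s₀) (h₁ : 0 < s₁) (U₀ U₁ v : V3) :
    localMaxwellian 1 s₁ U₁ v * (log (localMaxwellian 1 s₁ U₁ v) - log (localMaxwellian 1 s₀ U₀ v)) -
        localMaxwellian 1 s₁ U₁ v + localMaxwellian 1 s₀ U₀ v =
      localMaxwellian 1 s₁ U₁ v * (3 / 2 * (log (2 * Real.pi * s₀) - log (2 * Real.pi * s₁)) -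
        ‖v - U₁‖ ^ 2 / (2 * s₁) + ‖v - U₀‖ ^ 2 / (2 * s₀)) -
        localMaxwellian 1 s₁ U₁ v + localMaxwellian 1 s₀ U₀ v := by
  rw [log_lM_eq h₁, log_lM_eq h₀]
  ring

/-- `breg(M₁, M₀)` is integrable on `ℝ³`. -/
theorem integrable_breg_lM {s₀ s₁ : ℝ} (h₀ : 0 < s₀) (h₁ : 0 < s₁) (U₀ U₁ : V3) :
    Integrable fun v => localMaxwellian 1 s₁ U₁ v * (log (localMaxwellian 1 s₁ U₁ v) - log (localMaxwellian 1 s₀ U₀ v)) -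
      localMaxwellian 1 s₁ U₁ v + localMaxwellian 1 s₀ U₀ v := by
  have e : (fun v => localMaxwellian 1 s₁ U₁ v * (log (localMaxwellian 1 s₁ U₁ v) - log (localMaxwellian 1 s₀ U₀ v)) -
      localMaxwellian 1 s₁ U₁ v + localMaxwellian 1 s₀ U₀ v) = fun v =>
      localMaxwellian 1 s₁ U₁ v * (3 / 2 * (log (2 * Real.pi * s₀) - log (2 * Real.pi * s₁))) -
        (1 / (2 * s₁)) * (localMaxwellian 1 s₁ U₁ v * ‖v - U₁‖ ^ 2) +
        (1 / (2 * s₀)) * (localMaxwellian 1 s₁ U₁ v * ‖v - U₀‖ ^ 2) -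
        localMaxwellian 1 s₁ U₁ v + localMaxwellian 1 s₀ U₀ v := by
    funext v; rw [breg_lM_eq h₀ h₁]; ring
  rw [e]
  exact (((((integrable_lM h₁ U₁).mul_const _).sub ((integrable_lM_mul_norm_sub_pow h₁ U₁ U₁ 2).const_mul _)).add
    ((integrable_lM_mul_norm_sub_pow h₁ U₁ U₀ 2).const_mul _)).sub (integrable_lM h₁ U₁)).add (integrable_lM h₀ U₀)

/-- **RELATIVE ENTROPY OF TWO ISOTROPIC GAUSSIANS of `ℝ³`.**
`∫ breg(M_{s₁,U₁}, M_{s₀,U₀}) dv = (3/2)(s₁/s₀ − 1 − log(s₁/s₀)) + |U₁ − U₀|²/(2s₀)`. -/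
theorem integral_breg_lM {s₀ s₁ : ℝ} (h₀ : 0 < s₀) (h₁ : 0 < s₁) (U₀ U₁ : V3) :
    ∫ v, (localMaxwellian 1 s₁ U₁ v * (log (localMaxwellian 1 s₁ U₁ v) - log (localMaxwellian 1 s₀ U₀ v)) -
      localMaxwellian 1 s₁ U₁ v + localMaxwellian 1 s₀ U₀ v) =
      3 / 2 * (s₁ / s₀ - 1 - log (s₁ / s₀)) + ‖U₁ - U₀‖ ^ 2 / (2 * s₀) := by
  set c : ℝ := 3 / 2 * (log (2 * Real.pi * s₀) - log (2 * Real.pi * s₁)) with hc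
  have e : (fun v => localMaxwellian 1 s₁ U₁ v * (log (localMaxwellian 1 s₁ U₁ v) - log (localMaxwellian 1 s₀ U₀ v)) -
      localMaxwellian 1 s₁ U₁ v + localMaxwellian 1 s₀ U₀ v) = fun v =>
      localMaxwellian 1 s₁ U₁ v * c -
        (1 / (2 * s₁)) * (localMaxwellian 1 s₁ U₁ v * ‖v - U₁‖ ^ 2) +
        (1 / (2 * s₀)) * (localMaxwellian 1 s₁ U₁ v * ‖v - U₀‖ ^ 2) -
        localMaxwellian 1 s₁ U₁ v + localMaxwellian 1 s₀ U₀ v := by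
    funext v; rw [breg_lM_eq h₀ h₁, hc]; ring
  have i1 : Integrable fun v => localMaxwellian 1 s₁ U₁ v * c := (integrable_lM h₁ U₁).mul_const _
  have i2 : Integrable fun v => (1 / (2 * s₁)) * (localMaxwellian 1 s₁ U₁ v * ‖v - U₁‖ ^ 2) :=
    (integrable_lM_mul_norm_sub_pow h₁ U₁ U₁ 2).const_mul _
  have i3 : Integrable fun v => (1 / (2 * s₀)) * (localMaxwellian 1 s₁ U₁ v * ‖v - U₀‖ ^ 2) :=
    (integrable_lM_mul_norm_sub_pow h₁ U₁ U₀ 2).const_mul _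
  have i4 : Integrable fun v => localMaxwellian 1 s₁ U₁ v := integrable_lM h₁ U₁
  have i5 : Integrable fun v => localMaxwellian 1 s₀ U₀ v := integrable_lM h₀ U₀
  have i12 : Integrable fun v => localMaxwellian 1 s₁ U₁ v * c -
      (1 / (2 * s₁)) * (localMaxwellian 1 s₁ U₁ v * ‖v - U₁‖ ^ 2) := i1.sub i2
  have i123 : Integrable fun v => localMaxwellian 1 s₁ U₁ v * c -
      (1 / (2 * s₁)) * (localMaxwellian 1 s₁ U₁ v * ‖v - U₁‖ ^ 2) +
      (1 / (2 * s₀)) * (localMaxwellian 1 s₁ U₁ v * ‖v - U₀‖ ^ 2) := i12.add i3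
  have i1234 : Integrable fun v => localMaxwellian 1 s₁ U₁ v * c -
      (1 / (2 * s₁)) * (localMaxwellian 1 s₁ U₁ v * ‖v - U₁‖ ^ 2) +
      (1 / (2 * s₀)) * (localMaxwellian 1 s₁ U₁ v * ‖v - U₀‖ ^ 2) - localMaxwellian 1 s₁ U₁ v := i123.sub i4
  rw [e, integral_add i1234 i5, integral_sub i123 i4, integral_add i12 i3, integral_sub i1 i2, integral_mul_const,
    integral_const_mul, integral_const_mul, integral_lM h₁, integral_lM h₀, integral_lM_mul_norm_sub_sq' h₁,
    integral_lM_mul_norm_sub_sq' h₁, sub_self, norm_zero]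
  have hlog : c = -(3 / 2) * log (s₁ / s₀) := by
    rw [hc, log_mul (by positivity) h₀.ne', log_mul (by positivity) h₁.ne', log_div h₁.ne' h₀.ne']
    ring
  rw [hlog]
  field_simp
  ring

/-- **RELATIVE ENTROPY OF TWO MOLLIFIER BUMPS**: `∫ breg(G_h(· − u₁), G_h(· − u₀)) dv = |u₁ − u₀|²/(2h²)`. -/
theorem integral_breg_gauss {h : ℝ} (hh : 0 < h) (u₁ u₀ : V3) :
    ∫ v, (gauss h u₁ v * (log (gauss h u₁ v) - log (gauss h u₀ v)) - gauss h u₁ v + gauss h u₀ v) =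
      ‖u₁ - u₀‖ ^ 2 / (2 * h ^ 2) := by
  have hh2 : 0 < h ^ 2 := by positivity
  simp only [gauss_eq]
  rw [integral_breg_lM hh2 hh2, div_self hh2.ne', log_one]
  ring

/-- `breg(G_h(· − u₁), G_h(· − u₀))` is integrable. -/
theorem integrable_breg_gauss {h : ℝ} (hh : 0 < h) (u₁ u₀ : V3) :
    Integrable fun v => gauss h u₁ v * (log (gauss h u₁ v) - log (gauss h u₀ v)) - gauss h u₁ v + gauss h u₀ v := by
  have hh2 : 0 < h ^ 2 := by positivity
  simp only [gauss_eq]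
  exact integrable_breg_lM hh2 hh2 u₀ u₁

/-! ## Bounds on the Gaussian relative entropy -/

/-- The Gaussian relative entropy is nonnegative. -/
theorem kl_lM_nonneg {s₀ s₁ : ℝ} (h₀ : 0 < s₀) (h₁ : 0 < s₁) (U₀ U₁ : V3) :
    0 ≤ 3 / 2 * (s₁ / s₀ - 1 - log (s₁ / s₀)) + ‖U₁ - U₀‖ ^ 2 / (2 * s₀) :=
  add_nonneg (mul_nonneg (by norm_num) (by linarith [log_le_sub_one_of_pos (div_pos h₁ h₀)])) (by positivity)

/-- GENERAL BOUND: `KL(M₁‖M₀) ≤ (3/2)|s₁ − s₀|/min(s₀,s₁) + |U₁ − U₀|²/(2s₀)`. -/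
theorem kl_lM_le_general {s₀ s₁ : ℝ} (h₀ : 0 < s₀) (h₁ : 0 < s₁) (U₀ U₁ : V3) :
    3 / 2 * (s₁ / s₀ - 1 - log (s₁ / s₀)) + ‖U₁ - U₀‖ ^ 2 / (2 * s₀) ≤
      3 / 2 * (|s₁ - s₀| / min s₀ s₁) + ‖U₁ - U₀‖ ^ 2 / (2 * s₀) :=
  add_le_add (mul_le_mul_of_nonneg_left (ratio_sub_one_sub_log_le h₀ h₁) (by norm_num)) le_rfl

/-- PERTURBATIVE BOUND: if `|s₁ − s₀| ≤ s₀/2` then `KL(M₁‖M₀) ≤ 3((s₁ − s₀)/s₀)² + |U₁ − U₀|²/(2s₀)`. -/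
theorem kl_lM_le_perturbative {s₀ s₁ : ℝ} (h₀ : 0 < s₀) (hpert : |s₁ - s₀| ≤ s₀ / 2) (U₀ U₁ : V3) :
    3 / 2 * (s₁ / s₀ - 1 - log (s₁ / s₀)) + ‖U₁ - U₀‖ ^ 2 / (2 * s₀) ≤
      3 * ((s₁ - s₀) / s₀) ^ 2 + ‖U₁ - U₀‖ ^ 2 / (2 * s₀) := by
  have hr : 1 / 2 ≤ s₁ / s₀ := by
    rw [le_div_iff₀ h₀]
    have := (abs_le.1 hpert).1
    linarith
  have h := sub_one_sub_log_le_two_sq hr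
  have e : s₁ / s₀ - 1 = (s₁ - s₀) / s₀ := by field_simp
  rw [e] at h
  nlinarith [h]

/-! ## The `L¹` distance of two Maxwellians through their relative entropy -/

/-- `∫ M₁ log(M₁/M₀) = KL` (unit masses) and this integrand is integrable. -/
theorem integral_lM_mul_log_div {s₀ s₁ : ℝ} (h₀ : 0 < s₀) (h₁ : 0 < s₁) (U₀ U₁ : V3) :
    Integrable (fun v => localMaxwellian 1 s₁ U₁ v * log (localMaxwellian 1 s₁ U₁ v / localMaxwellian 1 s₀ U₀ v)) ∧
    ∫ v, localMaxwellian 1 s₁ U₁ v * log (localMaxwellian 1 s₁ U₁ v / localMaxwellian 1 s₀ U₀ v) =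
      3 / 2 * (s₁ / s₀ - 1 - log (s₁ / s₀)) + ‖U₁ - U₀‖ ^ 2 / (2 * s₀) := by
  have hM₁ : ∀ v, 0 < localMaxwellian 1 s₁ U₁ v := fun v => localMaxwellian_pos one_pos h₁ U₁ v
  have hM₀ : ∀ v, 0 < localMaxwellian 1 s₀ U₀ v := fun v => localMaxwellian_pos one_pos h₀ U₀ v
  have e : (fun v => localMaxwellian 1 s₁ U₁ v * log (localMaxwellian 1 s₁ U₁ v / localMaxwellian 1 s₀ U₀ v)) =
      fun v => (localMaxwellian 1 s₁ U₁ v * (log (localMaxwellian 1 s₁ U₁ v) - log (localMaxwellian 1 s₀ U₀ v)) -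
        localMaxwellian 1 s₁ U₁ v + localMaxwellian 1 s₀ U₀ v) +
        localMaxwellian 1 s₁ U₁ v - localMaxwellian 1 s₀ U₀ v := by
    funext v
    rw [log_div (hM₁ v).ne' (hM₀ v).ne']
    ring
  rw [e]
  have iA : Integrable fun v => (localMaxwellian 1 s₁ U₁ v * (log (localMaxwellian 1 s₁ U₁ v) -
      log (localMaxwellian 1 s₀ U₀ v)) - localMaxwellian 1 s₁ U₁ v + localMaxwellian 1 s₀ U₀ v) +
      localMaxwellian 1 s₁ U₁ v := (integrable_breg_lM h₀ h₁ U₀ U₁).add (integrable_lM h₁ U₁)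
  have iB : Integrable fun v => (localMaxwellian 1 s₁ U₁ v * (log (localMaxwellian 1 s₁ U₁ v) -
      log (localMaxwellian 1 s₀ U₀ v)) - localMaxwellian 1 s₁ U₁ v + localMaxwellian 1 s₀ U₀ v) +
      localMaxwellian 1 s₁ U₁ v - localMaxwellian 1 s₀ U₀ v := iA.sub (integrable_lM h₀ U₀)
  refine ⟨iB, ?_⟩
  rw [integral_sub iA (integrable_lM h₀ U₀), integral_add (integrable_breg_lM h₀ h₁ U₀ U₁) (integrable_lM h₁ U₁),
    integral_breg_lM h₀ h₁, integral_lM h₁, integral_lM h₀]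
  ring

/-- **`L¹` VIA RELATIVE ENTROPY**: if `KL(M₁‖M₀) ≤ c²` (`c ≥ 0`) then `∫ |M₁ − M₀| dv ≤ 2c`
(parametric Pinsker `∫|f − g| ≤ KL/(2τ) + 2τ` at `τ = c/2`, and `τ → 0` when `c = 0`). -/
theorem integral_abs_lM_sub_lM_le {s₀ s₁ : ℝ} (h₀ : 0 < s₀) (h₁ : 0 < s₁) (U₀ U₁ : V3) {c : ℝ} (hc : 0 ≤ c)
    (hKL : 3 / 2 * (s₁ / s₀ - 1 - log (s₁ / s₀)) + ‖U₁ - U₀‖ ^ 2 / (2 * s₀) ≤ c ^ 2) :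
    ∫ v, |localMaxwellian 1 s₁ U₁ v - localMaxwellian 1 s₀ U₀ v| ≤ 2 * c := by
  obtain ⟨hint, hval⟩ := integral_lM_mul_log_div h₀ h₁ U₀ U₁
  have hP : ∀ τ : ℝ, 0 < τ → ∫ v, |localMaxwellian 1 s₁ U₁ v - localMaxwellian 1 s₀ U₀ v| ≤ c ^ 2 / (2 * τ) + 2 * τ := by
    intro τ hτ
    have h := EEP.integral_abs_sub_le_klDiv_param (μ := (volume : Measure V3))
      (fun v => (localMaxwellian_pos one_pos h₁ U₁ v).le) (fun v => localMaxwellian_pos one_pos h₀ U₀ v)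
      (integrable_lM h₁ U₁) (integrable_lM h₀ U₀) (integral_lM h₁ U₁) (integral_lM h₀ U₀) hint hτ
    rw [hval] at h
    exact h.trans (add_le_add (div_le_div_of_nonneg_right hKL (by positivity)) le_rfl)
  rcases hc.eq_or_lt with h0 | hcp
  · subst h0
    rw [mul_zero]
    refine le_of_forall_pos_le_add fun ε hε => ?_
    have h := hP (ε / 2) (half_pos hε)
    simp only [ne_eq, OfNat.ofNat_ne_zero, not_false_eq_true, zero_pow, zero_div, zero_add] at h
    linarith
  · have h := hP (c / 2) (half_pos hcp)
    have e : c ^ 2 / (2 * (c / 2)) + 2 * (c / 2) = 2 * c := by field_simp; ring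
    rwa [e] at h

end PerContact

/-- Registered anchor of this helper file (`--supports stmt-AtomisticToContinuum-14868`, helper of
`stub_perContact`): the relative entropy of two isotropic Gaussians of `ℝ³`. -/
theorem bhPerContact_gaussKL_anchor : ∀ (s₀ s₁ : ℝ), 0 < s₀ → 0 < s₁ → ∀ (U₀ U₁ : V3), ∫ v, (Literature.Analysis.FluidPDE.localMaxwellian 1 s₁ U₁ v * (Real.log (Literature.Analysis.FluidPDE.localMaxwellian 1 s₁ U₁ v) - Real.log (Literature.Analysis.FluidPDE.localMaxwellian 1 s₀ U₀ v)) - Literature.Analysis.FluidPDE.localMaxwellian 1 s₁ U₁ v + Literature.Analysis.FluidPDE.localMaxwellian 1 s₀ U₀ v) = 3 / 2 * (s₁ / s₀ - 1 - Real.log (s₁ / s₀)) + ‖U₁ - U₀‖ ^ 2 / (2 * s₀) :=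
  fun _ _ h₀ h₁ U₀ U₁ => PerContact.integral_breg_lM h₀ h₁ U₀ U₁

end

end Summit.AtomisticToContinuum.HydrodynamicLimit.Theorems.BlockHDissipation
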